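import Summits.Ventures.PercRepro.Night2TwoFatCells

/-!
# PercRepro — the `(7, 5)` cell `(3, 1)` at `|G| = 16` through two fat hyperplanes with DISJOINT missed sets; residues G (night-2, gen 22)

Two thin members missing `≤ 2` points each with DISJOINT missed sets bound the covering bases of a target of size `s` by
`cntDisjoint ρ s = C(s, ρ) − 2·C(s − 2, ρ) + C(s − 4, ρ)` (`card_coverBases_le_cntDisjoint`; convexity `choose_disjoint_le`);
with gen 20's chord at `(3, 1)`, `n = 15` the count sum is `1.0074 ≥ 1` (`countSum_three_one_fifteen_dj`), so the cell `(3, 1)`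
at `|G| = 16` closes unless every two fat thin members have meeting missed sets (`MeetingFat`).  **`shadowHall_seven_five_of_residuesG`**
= residues E (`Night2TwoFatCells`) with that clause at `(3, 1)`, `|G| = 16`.
-/

namespace PercRepro.Shadow

open Finset PerFlat ThmH

/-- The count function of two fat hyperplanes (`≤ 2` missed points each) with disjoint missed sets:
`C(s, ρ) − 2·C(s − 2, ρ) + C(s − 4, ρ)`. -/
noncomputable def cntDisjoint (ρ s : ℕ) : ℚ :=
  (s.choose ρ : ℚ) - 2 * ((s - 2).choose ρ : ℚ) + ((s - 4).choose ρ : ℚ)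

/-- `cntDisjoint 5 s > 0` for `6 ≤ s ≤ 15`. -/
theorem cntDisjoint_five_pos : ∀ s, 6 ≤ s → s ≤ 15 → 0 < cntDisjoint 5 s := by
  intro s h1 h2
  unfold cntDisjoint
  interval_cases s <;> norm_num [Nat.choose_eq_descFactorial_div_factorial, Nat.descFactorial, Nat.factorial]

/-- **Binomial convexity behind the disjoint count**: `a₀, a₁ ≤ 2`, `b_i + a_i = m + 4`, `x ≤ b₀, b₁`, `x + a₀ + a₁ ≤ m + 4`
(no shared missed point) ⟹ `C(x, r+1) + 2·C(m+2, r+1) ≤ C(b₀, r+1) + C(b₁, r+1) + C(m, r+1)`. -/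
theorem choose_disjoint_le (r m a₀ a₁ b₀ b₁ x : ℕ) (h₀ : a₀ ≤ 2) (h₁ : a₁ ≤ 2)
    (hb₀ : b₀ + a₀ = m + 4) (hb₁ : b₁ + a₁ = m + 4) (hx₀ : x ≤ b₀) (hx₁ : x ≤ b₁)
    (hx : x + a₀ + a₁ ≤ m + 4) :
    x.choose (r + 1) + 2 * (m + 2).choose (r + 1) ≤
      b₀.choose (r + 1) + b₁.choose (r + 1) + m.choose (r + 1) := by
  have p1 : (m + 1).choose (r + 1) = m.choose r + m.choose (r + 1) := Nat.choose_succ_succ m r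
  have p2 : (m + 2).choose (r + 1) = (m + 1).choose r + (m + 1).choose (r + 1) :=
    Nat.choose_succ_succ (m + 1) r
  have p3 : (m + 3).choose (r + 1) = (m + 2).choose r + (m + 2).choose (r + 1) :=
    Nat.choose_succ_succ (m + 2) r
  have p4 : (m + 4).choose (r + 1) = (m + 3).choose r + (m + 3).choose (r + 1) :=
    Nat.choose_succ_succ (m + 3) r
  have q1 : m.choose r ≤ (m + 1).choose r := Nat.choose_le_choose r (by omega)
  have q2 : (m + 1).choose r ≤ (m + 2).choose r := Nat.choose_le_choose r (by omega)
  have q3 : (m + 2).choose r ≤ (m + 3).choose r := Nat.choose_le_choose r (by omega)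
  interval_cases a₀ <;> interval_cases a₁ <;>
    rcases (show b₀ = m + 4 ∨ b₀ = m + 3 ∨ b₀ = m + 2 by omega) with rfl | rfl | rfl <;>
    rcases (show b₁ = m + 4 ∨ b₁ = m + 3 ∨ b₁ = m + 2 by omega) with rfl | rfl | rfl <;>
    rcases (show x ≤ m ∨ x = m + 1 ∨ x = m + 2 ∨ x = m + 3 ∨ x = m + 4 by omega) with
      h | rfl | rfl | rfl | rfl <;>
    first
      | omega
      | (have hxc := Nat.choose_le_choose (r + 1) h; omega)

variable {α : Type*} [DecidableEq α] {M : Matroid α} [M.Finite]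

open scoped Classical in
/-- **The disjoint two-hyperplane count**: two rank-`≤ q` sets `H₀, H₁ ⊇ K` missing `≤ 2` points of `G` each with DISJOINT
missed sets bound the covering bases of every target `S ⊆ G` by `cntDisjoint ρ |S ∖ K|`. -/
theorem card_coverBases_le_cntDisjoint {q ρ : ℕ} {G : Finset α} (hk : kColoops M G + ρ = q + 1) (hρ : 4 ≤ ρ)
    {H₀ H₁ : Finset α} (hK₀ : coloops M G ⊆ H₀) (hH₀ : M.eRk (H₀ : Set α) ≤ (q : ℕ∞))
    (hK₁ : coloops M G ⊆ H₁) (hH₁ : M.eRk (H₁ : Set α) ≤ (q : ℕ∞))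
    (hm₀ : (G \ H₀).card ≤ 2) (hm₁ : (G \ H₁).card ≤ 2) (hdis : (G \ H₀) ∩ (G \ H₁) = ∅)
    {S : Finset α} (hSG : S ⊆ G) :
    ((coverBases M G S ρ).card : ℚ) ≤ cntDisjoint ρ (S \ coloops M G).card := by
  set S' := S \ coloops M G with hS'
  have hS'G : S' ⊆ G := Finset.sdiff_subset.trans hSG
  by_cases hsmall : S'.card < ρ
  · have h0 : (coverBases M G S ρ).card ≤ S'.card.choose ρ := card_coverBases_le G S ρ
    rw [Nat.choose_eq_zero_of_lt hsmall] at h0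
    have h0' : (coverBases M G S ρ).card = 0 := by omega
    unfold cntDisjoint
    rw [h0', Nat.choose_eq_zero_of_lt hsmall, Nat.choose_eq_zero_of_lt (by omega),
      Nat.choose_eq_zero_of_lt (by omega)]
    norm_num
  push Not at hsmall
  obtain ⟨r, rfl⟩ : ∃ r, ρ = r + 1 := ⟨ρ - 1, by omega⟩
  obtain ⟨m, hm⟩ : ∃ m, S'.card = m + 4 := ⟨S'.card - 4, by omega⟩
  have h1 := card_coverBases_le_of_two_subset_rank hk hK₀ hH₀ hK₁ hH₁ S
  have h2 := card_inter_inter_le (H₀ := H₀) (H₁ := H₁) hS'G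
  have hc : ((G \ H₀) ∩ (G \ H₁)).card = 0 := by rw [hdis]; rfl
  have ha₀ : (S' \ H₀).card ≤ 2 := (Finset.card_le_card (Finset.sdiff_subset_sdiff hS'G le_rfl)).trans hm₀
  have ha₁ : (S' \ H₁).card ≤ 2 := (Finset.card_le_card (Finset.sdiff_subset_sdiff hS'G le_rfl)).trans hm₁
  have hb₀ := Finset.card_sdiff_add_card_inter S' H₀
  have hb₁ := Finset.card_sdiff_add_card_inter S' H₁
  have hx₀ : (S' ∩ H₀ ∩ H₁).card ≤ (S' ∩ H₀).card := Finset.card_le_card Finset.inter_subset_left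
  have hx₁ : (S' ∩ H₀ ∩ H₁).card ≤ (S' ∩ H₁).card := by
    apply Finset.card_le_card
    intro y hy
    simp only [Finset.mem_inter] at hy ⊢
    exact ⟨hy.1.1, hy.2⟩
  have h3 := choose_disjoint_le r m (S' \ H₀).card (S' \ H₁).card (S' ∩ H₀).card (S' ∩ H₁).card
    (S' ∩ H₀ ∩ H₁).card ha₀ ha₁ (by omega) (by omega) hx₀ hx₁ (by omega)
  rw [← hS'] at h1
  rw [hm] at h1
  have h4 : (coverBases M G S (r + 1)).card + 2 * (m + 2).choose (r + 1) ≤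
      (m + 4).choose (r + 1) + m.choose (r + 1) := by omega
  unfold cntDisjoint
  rw [hm, show m + 4 - 2 = m + 2 by omega, show m + 4 - 4 = m by omega]
  have h5 := (Nat.cast_le (α := ℚ)).2 h4
  push_cast at h5
  linarith

/-- The count sum of the cell `(3, 1)` at `n = 15` with the disjoint count and `E = 5/24`: `1.0074… ≥ 1`. -/
theorem countSum_three_one_fifteen_dj :
    1 ≤ countSum 15 5 3 (cPrimeDGP 5 3 5 1 2) (5 / 24 : ℚ) (cntDisjoint 5) := by
  rw [cPrimeDGP_three_one_two]
  unfold countSum DGenP.cjG cntDisjoint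
  rw [show Finset.Icc 1 (15 - 5) = {1, 2, 3, 4, 5, 6, 7, 8, 9, 10} by decide]
  repeat rw [Finset.sum_insert (by decide)]
  rw [Finset.sum_singleton]
  norm_num [Nat.choose_eq_descFactorial_div_factorial, Nat.descFactorial, Nat.factorial]

open scoped Classical in
/-- **The cell `(3, 1)` at `|G| = 16` with two fat thin members with DISJOINT missed sets**: (LI_G) through the disjoint
count of the covering bases. -/
theorem localShadowHall_three_one_five_sixteen_of_disjoint {G : Finset α} (hG : G ∈ flatsQ M (5 + 1))
    (hd : (gr M \ G).card = 3) (hk : kColoops M G = 1)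
    (hs : ∀ e ∈ gr M, ∀ f ∈ gr M, e ≠ f → rkN M {e, f} = 2) (hl : ∀ e ∈ gr M, M.Indep {e})
    (hn : G.card = 16) {B₀ B₁ : Finset α} (hB₀ : B₀ ∈ thinMembers M 5 G) (hB₁ : B₁ ∈ thinMembers M 5 G)
    (hfat₀ : (G \ clF M B₀).card ≤ 2) (hfat₁ : (G \ clF M B₁).card ≤ 2)
    (hdis : (G \ clF M B₀) ∩ (G \ clF M B₁) = ∅) :
    LocalShadowHall M 5 G := by
  have hk' : kColoops M G + 5 = 5 + 1 := by omega
  have hd' : (gr M \ G).card ≤ 5 := by omega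
  have hm2 : ∀ B ∈ thinMembers M 5 G, 5 ≤ (B \ coloops M G).card → 2 ≤ (G \ clF M B).card :=
    fun B hB _ => two_le_card_sdiff_of_not_lay0 hG hd' (mem_thinMembers.1 hB).1 (mem_thinMembers.1 hB).2
  have hc2 : 0 ≤ cPrimeDGP 5 3 5 (kColoops M G) 2 := by
    rw [hk]; unfold cPrimeDGP capDG reqDGP phiQ; norm_num
  have hn15 : G.card - kColoops M G = 15 := by omega
  have hKG : coloops M G ⊆ G := fun y hy => (mem_coloops.1 hy).1
  have hnK : (G \ coloops M G).card = 15 := by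
    rw [Finset.card_sdiff_of_subset hKG, ← kColoops_eq_card_coloops]; omega
  refine localShadowHall_excess_of_count (d := 3) (ρ := 5) (m₁ := 2) hG hd (by norm_num) hk' (by norm_num)
    hs hl hc2 hm2 (E := (5 / 24 : ℚ)) (by norm_num) ?_ (cnt := cntDisjoint 5) ?_ ?_ ?_
  · intro S _ T hT
    have hT' : T ∈ (S \ coloops M G).powersetCard 5 := by
      unfold coverBases at hT
      exact (Finset.mem_filter.1 hT).1
    have h := sum_faceLoss_union_le (a := (8 / 35 : ℚ)) (b := (1 / 70 : ℚ)) hG hd (by norm_num) hk' (by omega)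
      hs hl (by norm_num) (by rw [hnK]; intro m h1 h2; exact DGenP.chord_three_one_15 m h1 (by omega))
      (by rw [hnK, hk, DGenP.excessBound_three_one_15]; norm_num) hT'
    rw [hnK, hk, DGenP.excessBound_three_one_15] at h
    exact h
  · intro s h1 h2
    rw [hn15] at h2
    exact cntDisjoint_five_pos s h1 h2
  · intro S hSG
    exact card_coverBases_le_cntDisjoint hk' (by norm_num) (coloops_subset_clF_of_mem_thinMembers hG hd' hB₀)
      (eRk_clF_le_of_mem_thinMembers hB₀) (coloops_subset_clF_of_mem_thinMembers hG hd' hB₁)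
      (eRk_clF_le_of_mem_thinMembers hB₁) hfat₀ hfat₁ hdis hSG
  · rw [hn15, hk]
    exact countSum_three_one_fifteen_dj

section SevenFiveG

variable {α' : Type} [DecidableEq α']

/-- «every two thin members missing `≤ m` points have MEETING missed sets». -/
abbrev MeetingFat (N : Matroid α') [N.Finite] (G : Finset α') (m : ℕ) : Prop :=
  ∀ B₀ ∈ thinMembers N 5 G, ∀ B₁ ∈ thinMembers N 5 G,
    (G \ clF N B₀).card ≤ m → (G \ clF N B₁).card ≤ m → (G \ clF N B₀) ∩ (G \ clF N B₁) ≠ ∅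

/-- **THE `(7, 5)` SHADOW ROW FOR EVERY FINITE MATROID MODULO THE RESIDUES G**: residues E with, at `(3, 1)`, `|G| = 16`,
the extra clause `MeetingFat N G 2` (residues E = `shadowHall_seven_five_of_residuesE`). -/
theorem shadowHall_seven_five_of_residuesG
    (h20 : ∀ (N : Matroid α') [N.Finite] (G : Finset α'), CellHyp N G →
      (gr N \ G).card = 2 → kColoops N G = 0 → FatMember N G 6 3 →
      (FatBasis N G 6 2 ∨ FatMember N G 6 2) → LocalShadowHall N 5 G)
    (h21 : ∀ (N : Matroid α') [N.Finite] (G : Finset α'), CellHyp N G →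
      (gr N \ G).card = 2 → kColoops N G = 1 → FatMember N G 5 4 →
      (FatBasis N G 5 3 ∨ FatMember N G 5 3) → LocalShadowHall N 5 G)
    (h30 : ∀ (N : Matroid α') [N.Finite] (G : Finset α'), CellHyp N G →
      (gr N \ G).card = 3 → kColoops N G = 0 → 10 ≤ G.card → G.card ≤ 13 → FatMember N G 6 2 →
      FatBasis N G 6 2 → (G.card = 13 → OneFatHyperplane N G 2) → LocalShadowHall N 5 G)
    (h31 : ∀ (N : Matroid α') [N.Finite] (G : Finset α'), CellHyp N G →
      (gr N \ G).card = 3 → kColoops N G = 1 → 11 ≤ G.card → G.card ≤ 17 → FatMember N G 5 2 →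
      (G.card = 17 → FatBasis N G 5 2) → (G.card = 17 → OneFatHyperplane N G 2) →
      (G.card = 16 → MeetingFat N G 2) →
      (G.card = 11 ∨ G.card = 15 ∨ G.card = 16 → FatBasis N G 5 3) →
      (12 ≤ G.card ∧ G.card ≤ 14 → FatBasis N G 5 4) → LocalShadowHall N 5 G)
    (h32 : ∀ (N : Matroid α') [N.Finite] (G : Finset α'), CellHyp N G →
      (gr N \ G).card = 3 → kColoops N G = 2 → FatMember N G 4 2 → LocalShadowHall N 5 G)
    (M : Matroid α') [M.Finite] : ShadowHall M 7 5 (phiK 7 5) := by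
  apply shadowHall_seven_five_of_residuesE h20 h21 h30 _ h32
  intro N _ G hcell hd hk h11 h17 hfm hb2 hone hb3 hb4
  by_cases hmeet : MeetingFat N G 2
  · exact h31 N G hcell hd hk h11 h17 hfm hb2 hone (fun _ => hmeet) hb3 hb4
  · by_cases hG16 : G.card = 16
    · unfold MeetingFat at hmeet
      push Not at hmeet
      obtain ⟨B₀, hB₀, B₁, hB₁, hf₀, hf₁, hdis⟩ := hmeet
      exact localShadowHall_three_one_five_sixteen_of_disjoint hcell.2.2.2 hd hk hcell.1 hcell.2.1 hG16
        hB₀ hB₁ hf₀ hf₁ hdis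
    · exact h31 N G hcell hd hk h11 h17 hfm hb2 hone (fun h => absurd h hG16) hb3 hb4

end SevenFiveG

end PercRepro.Shadow
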